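import Mathlib
import Literature.MathematicalPhysics.MHD.SolovevFluxSurfaceGGJThreshold
import HarnessLib

/-!
# The flux-surface Mercier slope and intercept of the Lee–Cerfon / PCF Solov'ev family in AXIS-REGULAR form:
# no `1/r`, no Cauchy–Schwarz cancellation, continuity down to `r = 0`, and the near-axis LIMIT of the threshold

Venture LADDER-GRIDFUSION, rung F1.MERCIER (cell `gridfusion`, seat gridfusion-model-7 (g4), 2026-08-27): the ANALYTIC LEVER for
a WHOLE-PROFILE Mercier certificate on the Lee–Cerfon / PCF Solov'ev family (companion of the Literature `lcLoop` series).  Context: on the surface `r` (`0 < r < R₀/2`) of `Ψ = psiLC κ F_B R₀ q₀ a`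
[Lee–Cerfon 2015 §4.1, bib `LeeCerfon2015`] with constant free function `F ≡ g`, Jardin's flux-coordinate Mercier function
(8.134) [bib `Jardin2010`] is `g²·M₂(r) − M₀(r)` (`SolovevFluxSurfaceGGJQuadratic`, gridfusion-sos-6) with
`M₂ = (πΦ″/V′ + C_s⟨1/G⟩)² − ⟨1/(uG)⟩(C_s²⟨u/G⟩ + C_sV″/V′)`, `M₀ = ⟨1/u⟩(C_s²⟨u/G⟩ + C_sV″/V′)`
(`u = R² = R₀² + 2rR₀cos t`, `G = |∇Ψ|²`, `⟨·⟩` the `w`-weighted loop average, `w ∝ u^{−1/2}`), and the criterion is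
`MercierCriterion ↔ 0 < M₂ ∧ M₀ < g²M₂` with no hypothesis (`SolovevFluxSurfaceGGJThreshold`, gridfusion-model-5).

THE OBSTRUCTION TO A WHOLE-PROFILE CERTIFICATE.  `G = (2crR₀)²·Q(r,t)` with `Q = u sin²t/κ² + (u cos t + rR₀sin²t)²/u`
positive and continuous INCLUDING `r = 0`, so `⟨1/G⟩, ⟨1/(uG)⟩, ⟨u/G⟩ ~ 1/r²`, the Cauchy–Schwarz pair
`⟨1/G⟩² − ⟨1/(uG)⟩⟨u/G⟩ ≤ 0` is a difference of two `~1/r⁴` quantities that cancels to relative order `r²`, while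
`M₂ ~ 1/r²`; and `V″/V′`, `Φ″/V′` carry `(1/r)∫cos t·u^{−3/2}`, `(1/r)∫₀^π cos t·u^{−5/2}`.  Zero-order enclosures of the
RAW integrals uniform in an `r`-box are therefore useless near the axis, and the per-surface certificates
(`Bench/SolovevPCF{Iter,Nstx}Mercier*Threshold`) stop at `ρ/ρ_e = 1/16` with «the analytic limit statement not claimed».

THE THREE FILES `SolovevMercierAxisRegular{,Ident,Limit}.lean` (exact real analysis, every member `κ, F_B, R₀, q₀ > 0`, any
shift `a`; THIS file = §1–§3, `…Ident` = §4–§5, `…Limit` = §6):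
* §1 `lcQ` (`lcGradSq = (2crR₀)²·lcQ`, `rfl`), `lcQ_pos` for `u > 0` (any `r`); the REGULAR divided-difference kernels
  `lcDivDiff3`, `lcDivDiff5` with `r·d₃ = (u√u)⁻¹ − R₀⁻³`, `r·d₅ = (u²√u)⁻¹ − R₀⁻⁵` (`√u − R₀ = 2rR₀cos t/(√u + R₀)`).
* §2 joint continuity of the nine regular kernels on `{u > 0} ⊂ ℝ²` (a set containing the axis line `r = 0`).
* §3 the nine AXIS-REGULAR loop integrals `W₁ = ∫u^{−1/2}`, `I_B = ∫u^{−3/2}`, `I₆ = ∫u^{−1/2}/Q`, `I₇ = ∫u^{−3/2}/Q`,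
  `I₈ = ∫u^{1/2}/Q`, `I_X = ∫(2cos t/R₀)u^{−1/2}/Q`, `I_Y = ∫4cos²t·u^{−3/2}/Q` (on `[0, 2π]`), `D₃ = ∫cos t·d₃`,
  `D₅ = ∫₀^π cos t·d₅`, and the numerators `N₂ = 9r²k²D₅² − 6C_skD₅I₆ + C_s²(I_X² − I₈I_Y/R₀²) + C_skI₇D₃`,
  `N₀ = C_s²k²I_BI₈ − C_sk³r²I_BD₃` (`k = κF_B/(R₀²q₀) = 2cR₀`, `C_s = csLC`).
* §4 the (8.134) loop integrals as regular ones: `∫w = (R₀³q₀/F_B)W₁`, `∫w/u = (R₀³q₀/F_B)I_B`,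
  `∫∂w/∂r = −(R₀³q₀/F_B)R₀·r·D₃`, `∫₀^π lcQKernelDr = −3R₀·r·D₅` (the `cos t·const` parts integrate to `0`),
  `∫w/G, ∫w/(uG), ∫uw/G = (R₀³q₀/F_B)/(k²r²)·I₆, I₇, I₈`; the two LINEAR identities `I₈ = R₀²(I₆ + rI_X)`,
  `R₀²I₇ = I₆ − rI_X + r²I_Y` (pointwise `1/(1+η) = 1 − η + η²/(1+η)`, `η = u/R₀² − 1 = (2r/R₀)cos t`) and hence the
  DEFECT IDENTITY `R₀²(I₆² − I₇I₈) = r²(R₀²I_X² − I₈I_Y)` — the Cauchy–Schwarz pair without cancellation.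
* §5 **`N₂ = (k²rW₁)²·M₂`, `N₀ = (k²rW₁)²·M₀`** (`lcRegSlopeNum_eq`, `lcRegInterceptNum_eq`); `N₀ > 0`;
  `0 < M₂ ↔ 0 < N₂`; **`MercierCriterion ↔ N₀(r) < g²·N₂(r)`** (`mercierCriterion_lcGGJData_iff_regular`, no slope
  hypothesis), the one-sided cell forms `…_of_regular` / `not_…_of_regular`, and `g_M(r) = √(N₀/N₂)`.
* §6 `N₂, N₀` (and the nine integrals) are CONTINUOUS on `[0, R₀/2)` — axis included (parametric interval integrals of
  jointly continuous kernels, Mathlib `continuous_parametric_intervalIntegral_of_continuous'`); hence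
  **`g_M(r) → √(N₀(0)/N₂(0))` as `r → 0⁺`** whenever `N₂(0) ≠ 0` (`tendsto_lcMercierThreshold_axis`): the flux-surface
  threshold HAS a limit at the magnetic axis, equal to a ratio of integrals over `[0, 2π]` of trigonometric rational
  functions (`u ≡ R₀²`, `Q(0,t) = R₀²(sin²t/κ² + cos²t)`).
USE (the lever): a kernel lane that encloses one-dimensional integrals uniformly for a parameter in a box (the tree's
`TProg.pmodelP` Taylor-model programs with `r` on the initial stack as a box register) can certify
`∀ r ∈ [r_k, r_{k+1}]: N₀(r) < G²·N₂(r)` cell by cell with cells of width set by the smoothness of BOUNDED kernels, the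
first cell being `[0, r₁]` — i.e. «Mercier holds at every `F ≥ G` on EVERY flux surface of the equilibrium» with no
separate near-axis analysis; `mercierCriterion_lcGGJData_of_regular` is the per-cell glue.
NOT here: closed forms of the `r = 0` integrals and the identification of `√(N₀(0)/N₂(0))` with the near-axis (Bateman)
threshold of `Mercier.NearAxis.MercierCriterion` (VALIDATED numerically for the ITER-like PCF instance to all printed
digits of the certified axis row, `0.6190279941`; the closed form
`N₀(0)/N₂(0) = F_B²κ(κ+1)(κ²+1)/(2q₀²(κ²+3κ−2))` is a follow-up); any enclosure; any instance; any claim about a device.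
HONEST FRAMING (LADDER-GRIDFUSION three columns): exact real analysis about MODEL objects (ideal MHD, Solov'ev profiles
`p′ = −C_s`, `FF′ = 0`, analytic fixed boundary); Mercier is a NECESSARY local-interchange criterion — «satisfies Mercier»
is not a stability claim.  Typer/prover: gridfusion-model-7 (g4), 2026-08-27.
-/

noncomputable section

open Real Set MeasureTheory intervalIntegral Filter Topology
open Literature.MathematicalPhysics.MHD Literature.MathematicalPhysics.MHD.Solovev
open Literature.MathematicalPhysics.MHD.GradShafranov Literature.MathematicalPhysics.MHD.Mercier.FluxForm

namespace Summit.Ventures.FusionMHD.Models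

namespace LcMercierRegular

/-! ## §1 The `r²`-normalised gradient kernel `Q` and the divided-difference kernels -/

/-- The `r`-free shape factor of `|∇Ψ|²` along the loop: `Q(r,t) = u sin²t/κ² + (u cos t + rR₀ sin²t)²/u`, so that
`|∇Ψ|² = (2crR₀)²·Q` (`lcGradSq_eq_mul_lcQ`); `Q` is positive and jointly continuous on `{u > 0}` INCLUDING `r = 0`
(`Q(0,t) = R₀²(sin²t/κ² + cos²t)`). [cite: LeeCerfon2015, §4.1 (boundary parametrisation)] -/
def lcQ (κ R₀ r t : ℝ) : ℝ :=
  lcU R₀ r t * Real.sin t ^ 2 / κ ^ 2 + (lcU R₀ r t * Real.cos t + r * R₀ * Real.sin t ^ 2) ^ 2 / lcU R₀ r t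

/-- `|∇Ψ|² = (2crR₀)²·Q`, `c = κF_B/(2R₀³q₀)` (definitional). [cite: LeeCerfon2015, §4.1 (boundary parametrisation)] -/
theorem lcGradSq_eq_mul_lcQ (κ FB R₀ q₀ r t : ℝ) :
    lcGradSq κ FB R₀ q₀ r t = (2 * (κ * FB / (2 * R₀ ^ 3 * q₀)) * r * R₀) ^ 2 * lcQ κ R₀ r t := rfl

/-- `(2crR₀)² = k²r²` with `k = κF_B/(R₀²q₀)` (`R₀ ≠ 0`). [folklore] -/
theorem lcAmpSq_eq {R₀ : ℝ} (hR₀ : R₀ ≠ 0) (κ FB q₀ r : ℝ) :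
    (2 * (κ * FB / (2 * R₀ ^ 3 * q₀)) * r * R₀) ^ 2 = (κ * FB / (R₀ ^ 2 * q₀)) ^ 2 * r ^ 2 := by
  field_simp

/-- `Q > 0` at every point of a loop with `u > 0` (any `r`, in particular `r = 0`). [folklore] -/
theorem lcQ_pos {κ R₀ r t : ℝ} (hκ : κ ≠ 0) (hu : 0 < lcU R₀ r t) : 0 < lcQ κ R₀ r t := by
  unfold lcQ
  have h1 : 0 ≤ lcU R₀ r t * Real.sin t ^ 2 / κ ^ 2 := by positivity
  have h2 : 0 ≤ (lcU R₀ r t * Real.cos t + r * R₀ * Real.sin t ^ 2) ^ 2 / lcU R₀ r t := by positivity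
  rcases eq_or_ne (Real.sin t) 0 with hs | hs
  · have hc : Real.cos t ^ 2 = 1 := by nlinarith [Real.sin_sq_add_cos_sq t, hs]
    have e : (lcU R₀ r t * Real.cos t + r * R₀ * Real.sin t ^ 2) ^ 2 = lcU R₀ r t * lcU R₀ r t := by
      linear_combination (lcU R₀ r t ^ 2) * hc
        + (2 * lcU R₀ r t * Real.cos t * r * R₀ * Real.sin t + 2 * r ^ 2 * R₀ ^ 2 * Real.sin t ^ 3
            + lcU R₀ r t * Real.cos t * 0) * hs
        + (r ^ 2 * R₀ ^ 2 * Real.sin t ^ 3 - 2 * r ^ 2 * R₀ ^ 2 * Real.sin t ^ 3) * hs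
    have : (lcU R₀ r t * Real.cos t + r * R₀ * Real.sin t ^ 2) ^ 2 / lcU R₀ r t = lcU R₀ r t := by
      rw [e, mul_div_assoc, div_self hu.ne', mul_one]
    linarith
  · have : 0 < lcU R₀ r t * Real.sin t ^ 2 / κ ^ 2 := by
      have := pow_pos (lt_of_le_of_ne (sq_nonneg (Real.sin t)) (Ne.symm (pow_ne_zero 2 hs))) 1
      positivity
    linarith

/-- The regular divided-difference kernel of `u^{−3/2}`: `d₃(r,t) = −2R₀cos t·(u + R₀√u + R₀²)/((√u + R₀)·u√u·R₀³)`,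
which satisfies `r·d₃ = (u√u)⁻¹ − R₀⁻³` (`mul_lcDivDiff3`) and has NO `1/r`. [folklore] -/
def lcDivDiff3 (R₀ r t : ℝ) : ℝ :=
  -(2 * R₀ * Real.cos t * (lcU R₀ r t + R₀ * Real.sqrt (lcU R₀ r t) + R₀ ^ 2))
    / ((Real.sqrt (lcU R₀ r t) + R₀) * (lcU R₀ r t * Real.sqrt (lcU R₀ r t)) * R₀ ^ 3)

/-- The regular divided-difference kernel of `u^{−5/2}`:
`d₅(r,t) = −2R₀cos t·(u² + u√uR₀ + uR₀² + √uR₀³ + R₀⁴)/((√u + R₀)·u²√u·R₀⁵)`, with `r·d₅ = (u²√u)⁻¹ − R₀⁻⁵`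
(`mul_lcDivDiff5`). [folklore] -/
def lcDivDiff5 (R₀ r t : ℝ) : ℝ :=
  -(2 * R₀ * Real.cos t * (lcU R₀ r t ^ 2 + lcU R₀ r t * Real.sqrt (lcU R₀ r t) * R₀ + lcU R₀ r t * R₀ ^ 2
      + Real.sqrt (lcU R₀ r t) * R₀ ^ 3 + R₀ ^ 4))
    / ((Real.sqrt (lcU R₀ r t) + R₀) * (lcU R₀ r t ^ 2 * Real.sqrt (lcU R₀ r t)) * R₀ ^ 5)

/-- `r·d₃(r,t) = (u√u)⁻¹ − R₀⁻³` (`u > 0`, `R₀ > 0`; uses `u − R₀² = 2rR₀cos t` and `√u − R₀ = (u − R₀²)/(√u + R₀)`).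
[folklore] -/
theorem mul_lcDivDiff3 {R₀ r t : ℝ} (hR₀ : 0 < R₀) (hu : 0 < lcU R₀ r t) :
    r * lcDivDiff3 R₀ r t = (lcU R₀ r t * Real.sqrt (lcU R₀ r t))⁻¹ - (R₀ ^ 3)⁻¹ := by
  unfold lcDivDiff3
  set s := Real.sqrt (lcU R₀ r t) with hs
  have hs0 : 0 < s := Real.sqrt_pos.2 hu
  have hss : s ^ 2 = lcU R₀ r t := Real.sq_sqrt hu.le
  have hkey : 2 * r * R₀ * Real.cos t = s ^ 2 - R₀ ^ 2 := by rw [hss]; unfold lcU; ring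
  rw [← hss]
  have h1 : s + R₀ ≠ 0 := by positivity
  have h2 : s ^ 2 * s ≠ 0 := by positivity
  have h3 : R₀ ^ 3 ≠ 0 := by positivity
  field_simp
  linear_combination (-(s ^ 2 + R₀ * s + R₀ ^ 2)) * hkey

/-- `r·d₅(r,t) = (u²√u)⁻¹ − R₀⁻⁵` (`u > 0`, `R₀ > 0`). [folklore] -/
theorem mul_lcDivDiff5 {R₀ r t : ℝ} (hR₀ : 0 < R₀) (hu : 0 < lcU R₀ r t) :
    r * lcDivDiff5 R₀ r t = (lcU R₀ r t ^ 2 * Real.sqrt (lcU R₀ r t))⁻¹ - (R₀ ^ 5)⁻¹ := by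
  unfold lcDivDiff5
  set s := Real.sqrt (lcU R₀ r t) with hs
  have hs0 : 0 < s := Real.sqrt_pos.2 hu
  have hss : s ^ 2 = lcU R₀ r t := Real.sq_sqrt hu.le
  have hkey : 2 * r * R₀ * Real.cos t = s ^ 2 - R₀ ^ 2 := by rw [hss]; unfold lcU; ring
  rw [← hss]
  have h1 : s + R₀ ≠ 0 := by positivity
  have h2 : (s ^ 2) ^ 2 * s ≠ 0 := by positivity
  have h3 : R₀ ^ 5 ≠ 0 := by positivity
  field_simp
  linear_combination (-((s ^ 2) ^ 2 + s ^ 2 * s * R₀ + s ^ 2 * R₀ ^ 2 + s * R₀ ^ 3 + R₀ ^ 4)) * hkey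


/-! ## §2 Joint continuity of the regular kernels on `{u > 0}` (which contains the axis `r = 0`) -/

section continuity

variable {κ R₀ : ℝ} (hκ : κ ≠ 0) (hR₀ : 0 < R₀)

/-- `(r,t) ↦ u` is continuous. [folklore] -/
theorem continuous_lcU₂ (R₀ : ℝ) : Continuous fun p : ℝ × ℝ => lcU R₀ p.1 p.2 := by
  unfold lcU; fun_prop

/-- `(r,t) ↦ Q` is continuous at every point with `u > 0`. [folklore] -/
theorem continuousAt_lcQ₂ (κ R₀ : ℝ) {p : ℝ × ℝ} (hu : 0 < lcU R₀ p.1 p.2) :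
    ContinuousAt (fun q : ℝ × ℝ => lcQ κ R₀ q.1 q.2) p := by
  have hc := continuous_lcU₂ R₀
  have hne : lcU R₀ p.1 p.2 ≠ 0 := hu.ne'
  unfold lcQ
  fun_prop (disch := assumption)

include hκ hR₀ in
/-- Joint continuity at every point of `{u > 0}` of the nine regular kernels
`(√u)⁻¹, (u√u)⁻¹, (√u)⁻¹/Q, (u√u)⁻¹/Q, √u/Q, (2cos t/R₀)(√u)⁻¹/Q, 4cos²t(u√u)⁻¹/Q, cos t·d₃, cos t·d₅`. [folklore] -/
theorem continuousAt_regKernels {p : ℝ × ℝ} (hu : 0 < lcU R₀ p.1 p.2) :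
    ContinuousAt (fun q : ℝ × ℝ => (Real.sqrt (lcU R₀ q.1 q.2))⁻¹) p
    ∧ ContinuousAt (fun q : ℝ × ℝ => (lcU R₀ q.1 q.2 * Real.sqrt (lcU R₀ q.1 q.2))⁻¹) p
    ∧ ContinuousAt (fun q : ℝ × ℝ => (Real.sqrt (lcU R₀ q.1 q.2))⁻¹ / lcQ κ R₀ q.1 q.2) p
    ∧ ContinuousAt (fun q : ℝ × ℝ => (lcU R₀ q.1 q.2 * Real.sqrt (lcU R₀ q.1 q.2))⁻¹ / lcQ κ R₀ q.1 q.2) p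
    ∧ ContinuousAt (fun q : ℝ × ℝ => Real.sqrt (lcU R₀ q.1 q.2) / lcQ κ R₀ q.1 q.2) p
    ∧ ContinuousAt (fun q : ℝ × ℝ => 2 * Real.cos q.2 / R₀ * (Real.sqrt (lcU R₀ q.1 q.2))⁻¹ / lcQ κ R₀ q.1 q.2) p
    ∧ ContinuousAt (fun q : ℝ × ℝ =>
        4 * Real.cos q.2 ^ 2 * (lcU R₀ q.1 q.2 * Real.sqrt (lcU R₀ q.1 q.2))⁻¹ / lcQ κ R₀ q.1 q.2) p
    ∧ ContinuousAt (fun q : ℝ × ℝ => Real.cos q.2 * lcDivDiff3 R₀ q.1 q.2) p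
    ∧ ContinuousAt (fun q : ℝ × ℝ => Real.cos q.2 * lcDivDiff5 R₀ q.1 q.2) p := by
  have hc := continuous_lcU₂ R₀
  have hQ := continuousAt_lcQ₂ κ R₀ hu
  have hne : lcU R₀ p.1 p.2 ≠ 0 := hu.ne'
  have hs : Real.sqrt (lcU R₀ p.1 p.2) ≠ 0 := (Real.sqrt_pos.2 hu).ne'
  have hQne : lcQ κ R₀ p.1 p.2 ≠ 0 := (lcQ_pos hκ hu).ne'
  have hus : lcU R₀ p.1 p.2 * Real.sqrt (lcU R₀ p.1 p.2) ≠ 0 := mul_ne_zero hne hs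
  have hus2 : lcU R₀ p.1 p.2 ^ 2 * Real.sqrt (lcU R₀ p.1 p.2) ≠ 0 := mul_ne_zero (pow_ne_zero 2 hne) hs
  have hsR : Real.sqrt (lcU R₀ p.1 p.2) + R₀ ≠ 0 := by positivity
  have hR3 : R₀ ^ 3 ≠ 0 := by positivity
  have hR5 : R₀ ^ 5 ≠ 0 := by positivity
  have hR : R₀ ≠ 0 := hR₀.ne'
  have hd3 : (Real.sqrt (lcU R₀ p.1 p.2) + R₀) * (lcU R₀ p.1 p.2 * Real.sqrt (lcU R₀ p.1 p.2)) * R₀ ^ 3 ≠ 0 := by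
    positivity
  have hd5 : (Real.sqrt (lcU R₀ p.1 p.2) + R₀) * (lcU R₀ p.1 p.2 ^ 2 * Real.sqrt (lcU R₀ p.1 p.2)) * R₀ ^ 5 ≠ 0 := by
    positivity
  unfold lcDivDiff3 lcDivDiff5
  refine ⟨?_, ?_, ?_, ?_, ?_, ?_, ?_, ?_, ?_⟩ <;> fun_prop (disch := assumption)

include hκ hR₀ in
/-- On a surface `0 ≤ r`, `2r < R₀` the nine regular kernels are continuous in `t` (sections of the joint statement).
[folklore] -/
theorem continuous_regKernels {r : ℝ} (hr : 0 ≤ r) (h2r : 2 * r < R₀) :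
    Continuous (fun t => (Real.sqrt (lcU R₀ r t))⁻¹)
    ∧ Continuous (fun t => (lcU R₀ r t * Real.sqrt (lcU R₀ r t))⁻¹)
    ∧ Continuous (fun t => (Real.sqrt (lcU R₀ r t))⁻¹ / lcQ κ R₀ r t)
    ∧ Continuous (fun t => (lcU R₀ r t * Real.sqrt (lcU R₀ r t))⁻¹ / lcQ κ R₀ r t)
    ∧ Continuous (fun t => Real.sqrt (lcU R₀ r t) / lcQ κ R₀ r t)
    ∧ Continuous (fun t => 2 * Real.cos t / R₀ * (Real.sqrt (lcU R₀ r t))⁻¹ / lcQ κ R₀ r t)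
    ∧ Continuous (fun t => 4 * Real.cos t ^ 2 * (lcU R₀ r t * Real.sqrt (lcU R₀ r t))⁻¹ / lcQ κ R₀ r t)
    ∧ Continuous (fun t => Real.cos t * lcDivDiff3 R₀ r t)
    ∧ Continuous (fun t => Real.cos t * lcDivDiff5 R₀ r t) := by
  have hu : ∀ t, 0 < lcU R₀ r t := lcU_pos hR₀ hr h2r
  have emb : Continuous fun t : ℝ => ((r, t) : ℝ × ℝ) := by fun_prop
  have key : ∀ {f : ℝ × ℝ → ℝ}, (∀ t, ContinuousAt f (r, t)) → Continuous fun t => f (r, t) := by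
    intro f hf
    rw [continuous_iff_continuousAt]
    intro t
    exact (hf t).comp emb.continuousAt
  refine ⟨key fun t => (continuousAt_regKernels hκ hR₀ (p := (r, t)) (hu t)).1,
    key fun t => (continuousAt_regKernels hκ hR₀ (p := (r, t)) (hu t)).2.1,
    key fun t => (continuousAt_regKernels hκ hR₀ (p := (r, t)) (hu t)).2.2.1,
    key fun t => (continuousAt_regKernels hκ hR₀ (p := (r, t)) (hu t)).2.2.2.1,
    key fun t => (continuousAt_regKernels hκ hR₀ (p := (r, t)) (hu t)).2.2.2.2.1,
    key fun t => (continuousAt_regKernels hκ hR₀ (p := (r, t)) (hu t)).2.2.2.2.2.1,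
    key fun t => (continuousAt_regKernels hκ hR₀ (p := (r, t)) (hu t)).2.2.2.2.2.2.1,
    key fun t => (continuousAt_regKernels hκ hR₀ (p := (r, t)) (hu t)).2.2.2.2.2.2.2.1,
    key fun t => (continuousAt_regKernels hκ hR₀ (p := (r, t)) (hu t)).2.2.2.2.2.2.2.2⟩

end continuity

/-! ## §3 The nine axis-regular loop integrals and the regular slope / intercept numerators -/

/-- `W₁(r) = ∫₀^{2π} u^{−1/2} dt` (so `∫w = (R₀³q₀/F_B)·W₁`, `V′ = 2π(R₀³q₀/F_B)W₁`). [cite: Jardin2010, §5.3 eq. (5.29)] -/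
def lcRegI0 (R₀ r : ℝ) : ℝ := ∫ t in (0 : ℝ)..(2 * π), (Real.sqrt (lcU R₀ r t))⁻¹

/-- `I_B(r) = ∫₀^{2π} u^{−3/2} dt` (`⟨1/R²⟩ = I_B/W₁`). [cite: Jardin2010, §5.3 eq. (5.30)] -/
def lcRegIB (R₀ r : ℝ) : ℝ := ∫ t in (0 : ℝ)..(2 * π), (lcU R₀ r t * Real.sqrt (lcU R₀ r t))⁻¹

/-- `I₆(r) = ∫₀^{2π} u^{−1/2}/Q dt` (`r²⟨1/|∇Ψ|²⟩ = I₆/(k²W₁)`). [cite: Jardin2010, §5.3 eq. (5.30)] -/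
def lcRegI6 (κ R₀ r : ℝ) : ℝ := ∫ t in (0 : ℝ)..(2 * π), (Real.sqrt (lcU R₀ r t))⁻¹ / lcQ κ R₀ r t

/-- `I₇(r) = ∫₀^{2π} u^{−3/2}/Q dt` (`r²⟨1/(R²|∇Ψ|²)⟩ = I₇/(k²W₁)`). [cite: Jardin2010, §5.3 eq. (5.30)] -/
def lcRegI7 (κ R₀ r : ℝ) : ℝ :=
  ∫ t in (0 : ℝ)..(2 * π), (lcU R₀ r t * Real.sqrt (lcU R₀ r t))⁻¹ / lcQ κ R₀ r t

/-- `I₈(r) = ∫₀^{2π} u^{1/2}/Q dt` (`r²⟨R²/|∇Ψ|²⟩ = I₈/(k²W₁)`). [cite: Jardin2010, §5.3 eq. (5.30)] -/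
def lcRegI8 (κ R₀ r : ℝ) : ℝ := ∫ t in (0 : ℝ)..(2 * π), Real.sqrt (lcU R₀ r t) / lcQ κ R₀ r t

/-- `I_X(r) = ∫₀^{2π} (2cos t/R₀)·u^{−1/2}/Q dt`: the `η/r`-weighted kernel, `η = u/R₀² − 1 = (2r/R₀)cos t`
(`r²⟨η/|∇Ψ|²⟩ = r·I_X/(k²W₁)`). [cite: Jardin2010, §8.5.4 eq. (8.134)] -/
def lcRegIX (κ R₀ r : ℝ) : ℝ :=
  ∫ t in (0 : ℝ)..(2 * π), 2 * Real.cos t / R₀ * (Real.sqrt (lcU R₀ r t))⁻¹ / lcQ κ R₀ r t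

/-- `I_Y(r) = ∫₀^{2π} 4cos²t·u^{−3/2}/Q dt`: the `η²/(r²(1+η))`-weighted kernel
(`r²⟨η²/((1+η)|∇Ψ|²)⟩ = r²·I_Y/(k²W₁)`). [cite: Jardin2010, §8.5.4 eq. (8.134)] -/
def lcRegIY (κ R₀ r : ℝ) : ℝ :=
  ∫ t in (0 : ℝ)..(2 * π), 4 * Real.cos t ^ 2 * (lcU R₀ r t * Real.sqrt (lcU R₀ r t))⁻¹ / lcQ κ R₀ r t

/-- `D₃(r) = ∫₀^{2π} cos t·d₃(r,t) dt`, the regularised `(1/r)∫cos t·u^{−3/2}` behind `V″/V′ = −D₃/(kW₁)`.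
[cite: Jardin2010, §8.5.4 eq. (8.134)] -/
def lcRegD3 (R₀ r : ℝ) : ℝ := ∫ t in (0 : ℝ)..(2 * π), Real.cos t * lcDivDiff3 R₀ r t

/-- `D₅(r) = ∫₀^{π} cos t·d₅(r,t) dt`, the regularised `(1/r)∫₀^π cos t·u^{−5/2}` behind `πΦ″/V′ = −3D₅/(kW₁)` (`g = 1`).
[cite: Jardin2010, §8.5.4 eq. (8.134)] -/
def lcRegD5 (R₀ r : ℝ) : ℝ := ∫ t in (0 : ℝ)..π, Real.cos t * lcDivDiff5 R₀ r t

/-- THE AXIS-REGULAR SLOPE NUMERATOR `N₂(r) = (k²rW₁)²·M₂(r)` (`lcRegSlopeNum_eq`):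
`N₂ = 9r²k²D₅² − 6C_s k D₅I₆ + C_s²(I_X² − I₈I_Y/R₀²) + C_s k I₇D₃`, `k = κF_B/(R₀²q₀)`, `C_s = csLC` — a polynomial in
regular integrals, the Cauchy–Schwarz pair `⟨1/G⟩² − ⟨1/(R²G)⟩⟨R²/G⟩` having been replaced by the cancellation-free
`I_X² − I₈I_Y/R₀²` (`lcReg_defect`). MODELLED: a functional of the analytic model surface. [cite: Jardin2010, §8.5.4 eq. (8.134)] -/
def lcRegSlopeNum (κ FB R₀ q₀ r : ℝ) : ℝ :=
  9 * r ^ 2 * (κ * FB / (R₀ ^ 2 * q₀)) ^ 2 * lcRegD5 R₀ r ^ 2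
    - 6 * csLC κ FB R₀ q₀ * (κ * FB / (R₀ ^ 2 * q₀)) * lcRegD5 R₀ r * lcRegI6 κ R₀ r
    + csLC κ FB R₀ q₀ ^ 2 * (lcRegIX κ R₀ r ^ 2 - lcRegI8 κ R₀ r * lcRegIY κ R₀ r / R₀ ^ 2)
    + csLC κ FB R₀ q₀ * (κ * FB / (R₀ ^ 2 * q₀)) * lcRegI7 κ R₀ r * lcRegD3 R₀ r

/-- THE AXIS-REGULAR INTERCEPT NUMERATOR `N₀(r) = (k²rW₁)²·M₀(r)` (`lcRegInterceptNum_eq`):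
`N₀ = C_s²k²I_BI₈ − C_s k³r²I_BD₃`. MODELLED: a functional of the analytic model surface. [cite: Jardin2010, §8.5.4 eq. (8.134)] -/
def lcRegInterceptNum (κ FB R₀ q₀ r : ℝ) : ℝ :=
  csLC κ FB R₀ q₀ ^ 2 * (κ * FB / (R₀ ^ 2 * q₀)) ^ 2 * lcRegIB R₀ r * lcRegI8 κ R₀ r
    - csLC κ FB R₀ q₀ * (κ * FB / (R₀ ^ 2 * q₀)) ^ 3 * r ^ 2 * lcRegIB R₀ r * lcRegD3 R₀ r



end LcMercierRegular

end Summit.Ventures.FusionMHD.Models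

end
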